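import Literature.Computability.Complexity.MoebiusBoundedDepthBourgainProofs
import Literature.NumberTheory.LFunctions.MoebiusWalshUniformHolds
import HarnessLib

/-!
# Bourgain 2013, Theorem 1 for `μ` and `λ` in the `Computability` rendering — discharged

Topic `Literature/Computability/Complexity`; proofs-only sibling of `MoebiusBoundedDepth.lean`
(the named facts `Literature.Computability.Complexity.Bourgain2013_moebius_walsh` and
`Literature.Computability.Complexity.Bourgain2013_liouville_walsh`) and of
`MoebiusBoundedDepthBourgainProofs.lean` (the proved bridges to the `NumberTheory` vendorings).
Everything in this file is PROVED (two theorems; no definition, no named fact).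

J. Bourgain, *Möbius–Walsh correlation bounds and an estimate of Mauduit and Rivat*, J. Anal.
Math. **119** (2013) 147–163 (= arXiv:1109.2784) [Bourgain2013MoebiusWalsh], **Theorem 1**
(p. 147, (0.3)): "For `λ` large enough, `max_{A ⊆ {0,…,λ-1}} |∑_{n < 2^λ} μ(n) w_A(n)| < 2^{λ - λ^{1/10}}`
(a similar estimate is also valid for the Liouville function)", `w_A(x) = ∏_{j ∈ A} (1 - 2x_j)`,
`x = ∑_{0 ≤ j < λ} x_j 2^j` ((0.1)).

The printed proof (Green 2012, Proposition 1 for the weights `|A| ≤ √λ/H`; for the others the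
Vaughan-type reduction of [M-R] Lemma 1, the type-II estimate of §2 and the type-I estimate of §3,
and the numerics of (3.10)) is entirely in the tree, in the `LFunctions` vocabulary (cube sums
`walshSum`, dyadic box sums `boxSum`), and concludes there as the discharges

* `Literature.NumberTheory.LFunctions.bourgain_moebius_walsh_uniform_holds`
  (`LFunctions/MoebiusWalshUniformHolds.lean`: `MoebiusWalsh.bourgain_moebius_walsh_uniform_of_typeII`
  — Green side, reduction, §3, assembly — applied to the per-box §2 estimate
  `MoebiusWalshTypeII.typeII_assemblyShape`);
* `Literature.NumberTheory.LFunctions.bourgain_liouville_walsh_uniform_holds`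
  (`LFunctions/MoebiusWalshTypeIIHighBox.lean`: `LiouvilleWalsh.bourgain_liouville_walsh_uniform_of_typeII`
  applied to `MoebiusWalshTypeII.typeII_perBox`).

This file only transports them to this topic's renderings (`∀ᶠ m`, `∑_{N ∈ range (2^m)}` read
through `Nat.testBit`, `walsh A`) along the proved bridges of
`MoebiusBoundedDepthBourgainProofs.lean`:

* `Bourgain2013_moebius_walsh_holds := Bourgain2013_moebius_walsh_of_uniform ‹μ discharge›`
  (the bridge's conclusion is the body of `Bourgain2013_moebius_walsh` verbatim; underneath it is
  `Literature.NumberTheory.Sieve.bourgain_moebius_walsh_iff_uniform`: binary expansion is a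
  bijection `{0,1}^m ≃ [0, 2^m)`, `μ(0) = 0`);
* `Bourgain2013_liouville_walsh_holds := Bourgain2013_liouville_walsh_of_uniform ‹λ discharge›`
  (exponent `c = 1/10` witnesses this topic's exponent-free reading of the Liouville remark).

## References

* J. Bourgain, J. Anal. Math. 119 (2013) 147–163; arXiv:1109.2784, Theorem 1, (0.3), and the
  parenthetical Liouville remark after Theorem 1. [Bourgain2013MoebiusWalsh]
-/

namespace Literature.Computability.Complexity

/-- **Bourgain 2013, Theorem 1 (Möbius–Walsh) in the `Computability` rendering — PROVED**
(discharge of the named fact `Bourgain2013_moebius_walsh`): eventually in `m`, for every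
`A : Finset (Fin m)`, `|∑_{N < 2^m} μ(N) · walsh A (j ↦ N.testBit j)| < 2 ^ (m - m^{1/10})`.
Transported from `Literature.NumberTheory.LFunctions.bourgain_moebius_walsh_uniform_holds` (the
tree's formalisation of the printed proof: Green's Proposition 1, the Vaughan-type reduction,
§§2–3, (3.10)) along the proved bridge `Bourgain2013_moebius_walsh_of_uniform`.
[cite: Bourgain2013MoebiusWalsh, Theorem 1, (0.3)] -/
theorem Bourgain2013_moebius_walsh_holds : Bourgain2013_moebius_walsh :=
  Bourgain2013_moebius_walsh_of_uniform
    Literature.NumberTheory.LFunctions.bourgain_moebius_walsh_uniform_holds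

/-- **Bourgain 2013, Theorem 1 for the Liouville function in the `Computability` rendering —
PROVED** (discharge of the named fact `Bourgain2013_liouville_walsh`): there is `c > 0` (namely
`c = 1/10`) such that eventually in `m`, for every `A : Finset (Fin m)`,
`|∑_{N < 2^m} λ(N) · walsh A (j ↦ N.testBit j)| < 2 ^ (m - m^c)`. Transported from
`Literature.NumberTheory.LFunctions.bourgain_liouville_walsh_uniform_holds` (exponent `1/10`, cube
sum; the tree's formalisation of the printed proof run for `λ`) along the proved bridge
`Bourgain2013_liouville_walsh_of_uniform`.
[cite: Bourgain2013MoebiusWalsh, Theorem 1 (Liouville remark)] -/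
theorem Bourgain2013_liouville_walsh_holds : Bourgain2013_liouville_walsh :=
  Bourgain2013_liouville_walsh_of_uniform
    Literature.NumberTheory.LFunctions.bourgain_liouville_walsh_uniform_holds

end Literature.Computability.Complexity
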